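/-
Copyright (c) 2026 the pub-hodgecm-mathlib formalisation cell (harness21).  Prover seat hodgecm-mathlib-F0P3a-p07 (g15) ((Cnt2′) chair): «S3-ram» seeding wave
(LEAD F0P3a-plan (g13); (α) block-law keeper F0P3a-p06 (g16)), RULING (18)(1): the chair lemma «tr ∕ det of the two centred W-blocks agree» for the `stub_Zpair_pm_odd_A` assembler F0P3-p01 (g19); 2026-09-02.
-/
import Literature.NumberTheory.Rogawski1990.TypeTwoRamifiedFrameLiteralCentred   -- ★ p849231 (A-p19 (g29), (h1) FILE 2): `coe_inv_mul_scalar_mul_mul_eq_smul`, `coe_scalar_mul_eq_smul`; brings the J0diff vocabulary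
import HarnessLib

/-!
# The ramified type-(2) transfer: the SPECTRAL TIE read on the two centred W-blocks — their `tr` and `det` (hence every residual invariant) AGREE (Rogawski 1990 §4.9)

Topic `NumberTheory/Rogawski1990`; namespace `Literature.NumberTheory.Rogawski1990` (+ `.SpectralTie` for the generic lemmas).  THEOREMS ONLY (no definition, no instance, no
notation, no named fact, no `sorry`); kernel lane `--supports stmt-HodgeConjecture-24833`.  Cell `pub/hodgecm-mathlib` (D-0151), crux H413; road «S3-ram» (count-neutral).
CONTEXT (chair RULINGS (17)(18)): the joint A-odd ∕ C cell `stub_Zpair_pm_odd_A` (assembler F0P3-p01 (g19)) applies F0P3a-p02 (g18)'s finite root law (★ p849444, heads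
`natCard_params_blockFrame_null_eq'`, `two_mul_natCard_params_blockFrame_quadraticChar_eq'`) to BOTH roots and needs their residual W-block invariants `(τ, det′, disc)` to COINCIDE
(`hκJ` of ★ p849403 `crossLiteral_lineRelations'`).  Those invariants are functions of `(tr, det)` of the centred W-blocks `B₀ − 1` (hyperbolic, `B₀ = k⁻¹·(s·ĝ_w)·k`, ★ (h1) A-p19)
and `s•γ₁ − 1` (anisotropic, ★ (T2) F0P3-p01 centring), which THIS FILE equates from the spectral tie `charpoly γ₁ = charpoly ĝ_w` (the J0diff binder `hχ`).
* §1 generic (`SpectralTie.*`, any field): `trace_eq_of_charpoly_eq`, `det_eq_of_charpoly_eq` (2 × 2, via `Matrix.charpoly_fin_two` coefficients);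
  `trace_smul_sub_one`, `det_smul_sub_one` (`tr(s•M − 1) = s·tr M − 2`, `det(s•M − 1) = s²·det M − s·tr M + 1`); `trace_units_conj_sub_one`, `det_units_conj_sub_one`
  (`k⁻¹(·)k` invariance); `trace_mul_self_fin_two` (`tr(M·M) = (tr M)² − 2·det M`); and the BLOCK-FRAME identities in F0P3a-p02's (B)-currency for `B = A⁻¹·Y·A` in block form with
  line value `B i₀ i₀ = λ`: `blockFrame_relTrace_eq` (`B_jj + B_ll − 2λ = tr Y − 3λ`), `two_mul_blockFrame_relDet_eq` (`2·(B_jl B_lj − (B_jj − λ)(B_ll − λ)) = tr(Y·Y) − (tr Y)² + 4λ·tr Y − 6λ²`).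
* §2 the SOCKET corollary `trace_det_centred_blocks_agree_ram` (J0diff binders `γH γ₁ hχ` + (h1)'s `s k`): `tr(↑B₀ − 1) = tr(↑(scalar s·γ₁) − 1)`, `det(↑B₀ − 1) = det(↑(scalar s·γ₁) − 1)`,
  `tr((↑B₀ − 1)²) = tr((↑(scalar s·γ₁) − 1)²)`.
HONEST LABEL: HC_CM is proved only modulo the 2 remaining named inputs (hLiu418 24832, h413 24833) until rung 0 closes; elementary linear algebra, count-neutral.

## References
* [Rogawski1990] J. D. Rogawski, *Automorphic Representations of Unitary Groups in Three Variables*, Ann. of Math. Stud. 123 (1990), §4.9 pp. 54–56 (the two literals share `χ_g`).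
* [LabesseLanglands1979] J.-P. Labesse, R. P. Langlands, *L-indistinguishability for SL(2)*, Canad. J. Math. 31 (1979), §2.
-/

set_option autoImplicit false

noncomputable section

open Matrix Polynomial NumberField IsDedekindDomain
open Literature.NumberTheory.Automorphic Literature.NumberTheory.Automorphic.UnitaryGroup Literature.NumberTheory.Automorphic.UnitaryLatticeTree
open scoped MatrixGroups

namespace Literature.NumberTheory.Rogawski1990

/-! ## §1 Generic linear algebra -/

namespace SpectralTie

variable {K : Type*} [Field K]

/-- Equal characteristic polynomials ⇒ equal traces (2 × 2). [cite: Rogawski1990, §4.9 p. 54] -/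
theorem trace_eq_of_charpoly_eq {M N : Matrix (Fin 2) (Fin 2) K} (h : M.charpoly = N.charpoly) : M.trace = N.trace := by
  have h1 := congrArg (fun p : K[X] => p.coeff 1) h
  simp only [Matrix.charpoly_fin_two, coeff_add, coeff_sub, coeff_X_pow, coeff_C_mul, coeff_X_one, coeff_C] at h1
  norm_num at h1
  exact h1

/-- Equal characteristic polynomials ⇒ equal determinants (2 × 2). [cite: Rogawski1990, §4.9 p. 54] -/
theorem det_eq_of_charpoly_eq {M N : Matrix (Fin 2) (Fin 2) K} (h : M.charpoly = N.charpoly) : M.det = N.det := by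
  have h0 := congrArg (fun p : K[X] => p.coeff 0) h
  simp only [Matrix.charpoly_fin_two, coeff_add, coeff_sub, coeff_X_pow, coeff_C_mul, coeff_X_zero, coeff_C] at h0
  norm_num at h0
  exact h0

/-- `tr(s•M − 1) = s·tr M − 2` (2 × 2). [cite: Rogawski1990, §4.9 p. 55] -/
theorem trace_smul_sub_one (s : K) (M : Matrix (Fin 2) (Fin 2) K) : (s • M - 1).trace = s * M.trace - 2 := by
  rw [Matrix.trace_fin_two, Matrix.trace_fin_two]
  simp only [Matrix.sub_apply, Matrix.smul_apply, smul_eq_mul, Matrix.one_apply_eq]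
  ring

/-- `det(s•M − 1) = s²·det M − s·tr M + 1` (2 × 2). [cite: Rogawski1990, §4.9 p. 55] -/
theorem det_smul_sub_one (s : K) (M : Matrix (Fin 2) (Fin 2) K) : (s • M - 1).det = s ^ 2 * M.det - s * M.trace + 1 := by
  rw [Matrix.det_fin_two, Matrix.det_fin_two, Matrix.trace_fin_two]
  simp only [Matrix.sub_apply, Matrix.smul_apply, smul_eq_mul, Matrix.one_apply_eq,
    Matrix.one_apply_ne (by decide : (0 : Fin 2) ≠ 1), Matrix.one_apply_ne (by decide : (1 : Fin 2) ≠ 0)]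
  ring

/-- Conjugation invariance: `tr(↑(k⁻¹·g·k) − 1) = tr(↑g − 1)`. [cite: Rogawski1990, §4.9 p. 55] -/
theorem trace_units_conj_sub_one {n : Type*} [Fintype n] [DecidableEq n] (k g : GL n K) :
    (((k⁻¹ * g * k : GL n K) : Matrix n n K) - 1).trace = ((g : Matrix n n K) - 1).trace := by
  have e : (((k⁻¹ * g * k : GL n K) : Matrix n n K) - 1) = ((k⁻¹ : GL n K) : Matrix n n K) * (((g : Matrix n n K)) - 1) * (k : Matrix n n K) := by
    rw [Matrix.mul_sub, Matrix.sub_mul, Matrix.mul_one, Units.inv_mul, Units.val_mul, Units.val_mul]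
  rw [e, Matrix.trace_mul_cycle, Units.mul_inv, Matrix.one_mul]

/-- Conjugation invariance: `det(↑(k⁻¹·g·k) − 1) = det(↑g − 1)`. [cite: Rogawski1990, §4.9 p. 55] -/
theorem det_units_conj_sub_one {n : Type*} [Fintype n] [DecidableEq n] (k g : GL n K) :
    (((k⁻¹ * g * k : GL n K) : Matrix n n K) - 1).det = ((g : Matrix n n K) - 1).det := by
  have e : (((k⁻¹ * g * k : GL n K) : Matrix n n K) - 1) = ((k⁻¹ : GL n K) : Matrix n n K) * (((g : Matrix n n K)) - 1) * (k : Matrix n n K) := by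
    rw [Matrix.mul_sub, Matrix.sub_mul, Matrix.mul_one, Units.inv_mul, Units.val_mul, Units.val_mul]
  have hkk : ((k⁻¹ : GL n K) : Matrix n n K).det * ((k : GL n K) : Matrix n n K).det = 1 := by
    rw [← Matrix.det_mul, Units.inv_mul, Matrix.det_one]
  rw [e, Matrix.det_mul, Matrix.det_mul]
  calc ((k⁻¹ : GL n K) : Matrix n n K).det * ((g : Matrix n n K) - 1).det * ((k : GL n K) : Matrix n n K).det
      = ((g : Matrix n n K) - 1).det * ((((k⁻¹ : GL n K) : Matrix n n K).det) * ((k : GL n K) : Matrix n n K).det) := by ring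
    _ = ((g : Matrix n n K) - 1).det := by rw [hkk, mul_one]

/-- `tr(M·M) = (tr M)² − 2·det M` (2 × 2, Cayley–Hamilton). [cite: Rogawski1990, §4.9 p. 55] -/
theorem trace_mul_self_fin_two (M : Matrix (Fin 2) (Fin 2) K) : (M * M).trace = M.trace ^ 2 - 2 * M.det := by
  rw [Matrix.trace_fin_two, Matrix.trace_fin_two, Matrix.det_fin_two]
  simp only [Matrix.mul_apply, Fin.sum_univ_two]
  ring

/-- A sum over `Fin 3` listed along three distinct indices (bookkeeping for the block frame). [cite: Rogawski1990, §4.9 p. 55] -/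
theorem sum_univ_three_of_ne {R : Type*} [AddCommMonoid R] (f : Fin 3 → R) {i₀ j l : Fin 3} (hij : i₀ ≠ j) (hil : i₀ ≠ l) (hjl : j ≠ l) :
    ∑ i, f i = f i₀ + f j + f l := by
  fin_cases i₀ <;> fin_cases j <;> fin_cases l <;> simp_all [Fin.sum_univ_three] <;> abel

/-- **BLOCK FRAME, RELATIVE TRACE** (F0P3a-p02's (B)-currency): for `B = A⁻¹·Y·A` in block form along `(i₀ | j, l)`: `B_jj + B_ll − 2·B_{i₀i₀} = tr Y − 3·B_{i₀i₀}`.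
[cite: Rogawski1990, §4.9 p. 55] -/
theorem blockFrame_relTrace_eq (A : GL (Fin 3) K) (Y B : Matrix (Fin 3) (Fin 3) K)
    (hY : ((A⁻¹ : GL (Fin 3) K) : Matrix (Fin 3) (Fin 3) K) * Y * (A : Matrix (Fin 3) (Fin 3) K) = B)
    {i₀ j l : Fin 3} (hij : i₀ ≠ j) (hil : i₀ ≠ l) (hjl : j ≠ l) :
    B j j + B l l - 2 * B i₀ i₀ = Y.trace - 3 * B i₀ i₀ := by
  have htr : B.trace = Y.trace := by
    rw [← hY, Matrix.trace_mul_cycle, Matrix.coe_units_inv, Matrix.mul_nonsing_inv _ (Matrix.isUnits_det_units A), Matrix.one_mul]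
  rw [← htr, Matrix.trace, sum_univ_three_of_ne (fun i => B.diag i) hij hil hjl]
  simp only [Matrix.diag_apply]
  ring

/-- **BLOCK FRAME, RELATIVE DETERMINANT** (F0P3a-p02's (B)-currency): for `B = A⁻¹·Y·A` with `B i₀ j = B i₀ l = B j i₀ = B l i₀ = 0`:
`2·(B_jl·B_lj − (B_jj − λ)(B_ll − λ)) = tr(Y·Y) − (tr Y)² + 4λ·tr Y − 6λ²`, `λ = B i₀ i₀`. [cite: Rogawski1990, §4.9 p. 55] -/
theorem two_mul_blockFrame_relDet_eq (A : GL (Fin 3) K) (Y B : Matrix (Fin 3) (Fin 3) K)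
    (hY : ((A⁻¹ : GL (Fin 3) K) : Matrix (Fin 3) (Fin 3) K) * Y * (A : Matrix (Fin 3) (Fin 3) K) = B)
    {i₀ j l : Fin 3} (hij : i₀ ≠ j) (hil : i₀ ≠ l) (hjl : j ≠ l)
    (hB₁ : B i₀ j = 0) (hB₂ : B i₀ l = 0) (hB₃ : B j i₀ = 0) (hB₄ : B l i₀ = 0) :
    2 * (B j l * B l j - (B j j - B i₀ i₀) * (B l l - B i₀ i₀)) = (Y * Y).trace - Y.trace ^ 2 + 4 * B i₀ i₀ * Y.trace - 6 * B i₀ i₀ ^ 2 := by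
  have hAinv : ((A : Matrix (Fin 3) (Fin 3) K)) * ((A⁻¹ : GL (Fin 3) K) : Matrix (Fin 3) (Fin 3) K) = 1 := by
    rw [Matrix.coe_units_inv, Matrix.mul_nonsing_inv _ (Matrix.isUnits_det_units A)]
  have htr : B.trace = Y.trace := by
    rw [← hY, Matrix.trace_mul_cycle, hAinv, Matrix.one_mul]
  have hsq : (B * B).trace = (Y * Y).trace := by
    have e : B * B = ((A⁻¹ : GL (Fin 3) K) : Matrix (Fin 3) (Fin 3) K) * (Y * Y) * (A : Matrix (Fin 3) (Fin 3) K) := by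
      rw [← hY]
      simp only [Matrix.mul_assoc]
      rw [← Matrix.mul_assoc (A : Matrix (Fin 3) (Fin 3) K) ((A⁻¹ : GL (Fin 3) K) : Matrix (Fin 3) (Fin 3) K), hAinv, Matrix.one_mul]
    rw [e, Matrix.trace_mul_cycle, hAinv, Matrix.one_mul]
  have htrB : B.trace = B i₀ i₀ + B j j + B l l := by
    rw [Matrix.trace, sum_univ_three_of_ne (fun i => B.diag i) hij hil hjl]; rfl
  have hsqB : (B * B).trace = B i₀ i₀ ^ 2 + (B j j ^ 2 + B l l ^ 2 + 2 * (B j l * B l j)) := by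
    rw [Matrix.trace, sum_univ_three_of_ne (fun i => (B * B).diag i) hij hil hjl]
    simp only [Matrix.diag_apply, Matrix.mul_apply]
    rw [sum_univ_three_of_ne (fun m => B i₀ m * B m i₀) hij hil hjl, sum_univ_three_of_ne (fun m => B j m * B m j) hij hil hjl,
      sum_univ_three_of_ne (fun m => B l m * B m l) hij hil hjl, hB₁, hB₂, hB₃, hB₄]
    ring
  rw [← hsq, ← htr, htrB, hsqB]
  ring

end SpectralTie

/-! ## §2 The socket corollary -/

section Socket

variable (L : Type) [Field L] [NumberField L] [IsCMField L] {v : HeightOneSpectrum (𝓞 ↥(maximalRealSubfield L))}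
  (w : PlacesOver L v) (hw : IsCMField.complexConj L • w.1 = w.1)

/-- **THE TWO CENTRED W-BLOCKS HAVE THE SAME `tr`, `det`, `tr(·²)` AFTER `− 1`** (J0diff binders `γH γ₁ hχ`; (h1) centring data `s k`):
`B₀ := k⁻¹·(scalar s·ĝ_w)·k` (hyperbolic, ★ A-p19) and `scalar s·γ₁` (anisotropic, ★ F0P3-p01) satisfy `tr(↑B₀ − 1) = tr(↑(scalar s·γ₁) − 1) (= s·tr ĝ_w − 2)`,
`det(↑B₀ − 1) = det(↑(scalar s·γ₁) − 1) (= s²·det ĝ_w − s·tr ĝ_w + 1)` and `tr((↑B₀ − 1)²) = tr((↑(scalar s·γ₁) − 1)²)` — so the residual invariants `(τ, det′, disc)` of the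
two roots coincide (F0P3-p01's `hκJ`). [cite: Rogawski1990, §4.9 pp. 54–55] [cite: LabesseLanglands1979, §2] -/
theorem trace_det_centred_blocks_agree_ram
    ⦃γH : ((cmDatum L 2 (Matrix.of fun i j : Fin 2 => if i.val + j.val + 1 = 2 then (1 : L) else 0)).Local v × (cmDatum L 1 (Matrix.of fun i j : Fin 1 => if i.val + j.val + 1 = 1 then (1 : L) else 0)).Local v)⦄
    (γ₁ : GL (Fin 2) (w.1.adicCompletion L))
    (hχ : (γ₁ : Matrix (Fin 2) (Fin 2) (w.1.adicCompletion L)).charpoly = (((γH.1.val : GL (Fin 2) (UnitaryGroup.LocalRing L v)).val.map (Pi.evalRingHom (fun w' : PlacesOver L v => w'.1.adicCompletion L) w))).charpoly)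
    (s : (w.1.adicCompletion L)ˣ) (k : GL (Fin 2) (w.1.adicCompletion L)) :
    ((((k⁻¹ * (Matrix.GeneralLinearGroup.scalar (Fin 2) s * ((localNonsplitEquiv (IsCMField.complexConj L) (Matrix.of fun i j : Fin 2 => if i.val + j.val + 1 = 2 then (1 : L) else 0) (IsCMField.complexConj_ne_one L) w hw γH.1).val : GL (Fin 2) (w.1.adicCompletion L))) * k) : GL (Fin 2) (w.1.adicCompletion L)) : Matrix (Fin 2) (Fin 2) (w.1.adicCompletion L)) - 1).trace =
        (((Matrix.GeneralLinearGroup.scalar (Fin 2) s * γ₁ : GL (Fin 2) (w.1.adicCompletion L)) : Matrix (Fin 2) (Fin 2) (w.1.adicCompletion L)) - 1).trace ∧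
      ((((k⁻¹ * (Matrix.GeneralLinearGroup.scalar (Fin 2) s * ((localNonsplitEquiv (IsCMField.complexConj L) (Matrix.of fun i j : Fin 2 => if i.val + j.val + 1 = 2 then (1 : L) else 0) (IsCMField.complexConj_ne_one L) w hw γH.1).val : GL (Fin 2) (w.1.adicCompletion L))) * k) : GL (Fin 2) (w.1.adicCompletion L)) : Matrix (Fin 2) (Fin 2) (w.1.adicCompletion L)) - 1).det =
        (((Matrix.GeneralLinearGroup.scalar (Fin 2) s * γ₁ : GL (Fin 2) (w.1.adicCompletion L)) : Matrix (Fin 2) (Fin 2) (w.1.adicCompletion L)) - 1).det ∧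
      (((((k⁻¹ * (Matrix.GeneralLinearGroup.scalar (Fin 2) s * ((localNonsplitEquiv (IsCMField.complexConj L) (Matrix.of fun i j : Fin 2 => if i.val + j.val + 1 = 2 then (1 : L) else 0) (IsCMField.complexConj_ne_one L) w hw γH.1).val : GL (Fin 2) (w.1.adicCompletion L))) * k) : GL (Fin 2) (w.1.adicCompletion L)) : Matrix (Fin 2) (Fin 2) (w.1.adicCompletion L)) - 1) *
          ((((k⁻¹ * (Matrix.GeneralLinearGroup.scalar (Fin 2) s * ((localNonsplitEquiv (IsCMField.complexConj L) (Matrix.of fun i j : Fin 2 => if i.val + j.val + 1 = 2 then (1 : L) else 0) (IsCMField.complexConj_ne_one L) w hw γH.1).val : GL (Fin 2) (w.1.adicCompletion L))) * k) : GL (Fin 2) (w.1.adicCompletion L)) : Matrix (Fin 2) (Fin 2) (w.1.adicCompletion L)) - 1)).trace =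
        ((((Matrix.GeneralLinearGroup.scalar (Fin 2) s * γ₁ : GL (Fin 2) (w.1.adicCompletion L)) : Matrix (Fin 2) (Fin 2) (w.1.adicCompletion L)) - 1) *
          (((Matrix.GeneralLinearGroup.scalar (Fin 2) s * γ₁ : GL (Fin 2) (w.1.adicCompletion L)) : Matrix (Fin 2) (Fin 2) (w.1.adicCompletion L)) - 1)).trace := by
  set ĝ : GL (Fin 2) (w.1.adicCompletion L) := ((localNonsplitEquiv (IsCMField.complexConj L) (Matrix.of fun i j : Fin 2 => if i.val + j.val + 1 = 2 then (1 : L) else 0) (IsCMField.complexConj_ne_one L) w hw γH.1).val : GL (Fin 2) (w.1.adicCompletion L)) with hĝ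
  -- `ĝ_w` IS the evaluated matrix (★ `coe_localNonsplitEquiv_apply` is `rfl`), so `hχ` reads on `ĝ`
  have hĝmat : (ĝ : Matrix (Fin 2) (Fin 2) (w.1.adicCompletion L)) = (((γH.1.val : GL (Fin 2) (UnitaryGroup.LocalRing L v)).val.map (Pi.evalRingHom (fun w' : PlacesOver L v => w'.1.adicCompletion L) w))) := rfl
  have htr : (γ₁ : Matrix (Fin 2) (Fin 2) (w.1.adicCompletion L)).trace = (ĝ : Matrix (Fin 2) (Fin 2) (w.1.adicCompletion L)).trace := by
    rw [hĝmat]; exact SpectralTie.trace_eq_of_charpoly_eq hχ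
  have hdet : (γ₁ : Matrix (Fin 2) (Fin 2) (w.1.adicCompletion L)).det = (ĝ : Matrix (Fin 2) (Fin 2) (w.1.adicCompletion L)).det := by
    rw [hĝmat]; exact SpectralTie.det_eq_of_charpoly_eq hχ
  -- both sides in the `s • M − 1` shape
  have hB₀ : (((k⁻¹ * (Matrix.GeneralLinearGroup.scalar (Fin 2) s * ĝ) * k : GL (Fin 2) (w.1.adicCompletion L)) : Matrix (Fin 2) (Fin 2) (w.1.adicCompletion L)) - 1)
      = (s : w.1.adicCompletion L) • ((k⁻¹ * ĝ * k : GL (Fin 2) (w.1.adicCompletion L)) : Matrix (Fin 2) (Fin 2) (w.1.adicCompletion L)) - 1 := by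
    rw [coe_inv_mul_scalar_mul_mul_eq_smul]
  have hA : (((Matrix.GeneralLinearGroup.scalar (Fin 2) s * γ₁ : GL (Fin 2) (w.1.adicCompletion L)) : Matrix (Fin 2) (Fin 2) (w.1.adicCompletion L)) - 1)
      = (s : w.1.adicCompletion L) • (γ₁ : Matrix (Fin 2) (Fin 2) (w.1.adicCompletion L)) - 1 := by
    rw [coe_scalar_mul_eq_smul]
  have hconj_tr : ((k⁻¹ * ĝ * k : GL (Fin 2) (w.1.adicCompletion L)) : Matrix (Fin 2) (Fin 2) (w.1.adicCompletion L)).trace = (ĝ : Matrix (Fin 2) (Fin 2) (w.1.adicCompletion L)).trace := by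
    rw [Units.val_mul, Units.val_mul, Matrix.trace_mul_cycle, Units.mul_inv, Matrix.one_mul]
  have hconj_det : ((k⁻¹ * ĝ * k : GL (Fin 2) (w.1.adicCompletion L)) : Matrix (Fin 2) (Fin 2) (w.1.adicCompletion L)).det = (ĝ : Matrix (Fin 2) (Fin 2) (w.1.adicCompletion L)).det := by
    have hkk : ((k⁻¹ : GL (Fin 2) (w.1.adicCompletion L)) : Matrix (Fin 2) (Fin 2) (w.1.adicCompletion L)).det * ((k : GL (Fin 2) (w.1.adicCompletion L)) : Matrix (Fin 2) (Fin 2) (w.1.adicCompletion L)).det = 1 := by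
      rw [← Matrix.det_mul, Units.inv_mul, Matrix.det_one]
    rw [Units.val_mul, Units.val_mul, Matrix.det_mul, Matrix.det_mul]
    calc ((k⁻¹ : GL (Fin 2) (w.1.adicCompletion L)) : Matrix (Fin 2) (Fin 2) (w.1.adicCompletion L)).det * (ĝ : Matrix (Fin 2) (Fin 2) (w.1.adicCompletion L)).det * ((k : GL (Fin 2) (w.1.adicCompletion L)) : Matrix (Fin 2) (Fin 2) (w.1.adicCompletion L)).det
        = (ĝ : Matrix (Fin 2) (Fin 2) (w.1.adicCompletion L)).det * ((((k⁻¹ : GL (Fin 2) (w.1.adicCompletion L)) : Matrix (Fin 2) (Fin 2) (w.1.adicCompletion L)).det) * ((k : GL (Fin 2) (w.1.adicCompletion L)) : Matrix (Fin 2) (Fin 2) (w.1.adicCompletion L)).det) := by ring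
      _ = (ĝ : Matrix (Fin 2) (Fin 2) (w.1.adicCompletion L)).det := by rw [hkk, mul_one]
  have h1 : (((k⁻¹ * (Matrix.GeneralLinearGroup.scalar (Fin 2) s * ĝ) * k : GL (Fin 2) (w.1.adicCompletion L)) : Matrix (Fin 2) (Fin 2) (w.1.adicCompletion L)) - 1).trace =
      (((Matrix.GeneralLinearGroup.scalar (Fin 2) s * γ₁ : GL (Fin 2) (w.1.adicCompletion L)) : Matrix (Fin 2) (Fin 2) (w.1.adicCompletion L)) - 1).trace := by
    rw [hB₀, hA, SpectralTie.trace_smul_sub_one, SpectralTie.trace_smul_sub_one, hconj_tr, htr]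
  have h2 : (((k⁻¹ * (Matrix.GeneralLinearGroup.scalar (Fin 2) s * ĝ) * k : GL (Fin 2) (w.1.adicCompletion L)) : Matrix (Fin 2) (Fin 2) (w.1.adicCompletion L)) - 1).det =
      (((Matrix.GeneralLinearGroup.scalar (Fin 2) s * γ₁ : GL (Fin 2) (w.1.adicCompletion L)) : Matrix (Fin 2) (Fin 2) (w.1.adicCompletion L)) - 1).det := by
    rw [hB₀, hA, SpectralTie.det_smul_sub_one, SpectralTie.det_smul_sub_one, hconj_tr, hconj_det, htr, hdet]
  refine ⟨h1, h2, ?_⟩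
  rw [SpectralTie.trace_mul_self_fin_two, SpectralTie.trace_mul_self_fin_two, h1, h2]

end Socket

end Literature.NumberTheory.Rogawski1990

end
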